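import Summits.BirchSwinnertonDyer.BirchSwinnertonDyer.Theorems.ResidualThetaTransportAtTwoSignedMuVanishingAtTwoPlusCuspSpanFlat
import Summits.BirchSwinnertonDyer.BirchSwinnertonDyer.Theorems.ResidualThetaTransportAtTwoSignedMuVanishingAtTwoPlusLineV42
import HarnessLib

/-!
# Route `ResidualThetaTransportAtTwo`, crux Kμ⁺ `SignedMuVanishingAtTwoPlus` (stmt-BirchSwinnertonDyer-20689),
# line `birth`, stub `stub_flatMuZeroAtTwo`: the HECKE-WEAKENED spanning hypothesis (G⁰)_N — only the
# `T₂`-nilpotent part of the mod-2 homology of `X₀(N)` matters for FLAT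

Cell `bsd-wall`, width seat `bsd-wall-rtt-p4-w2` (g3). THEOREMS ONLY (no `def`, no named fact, no `sorry`); helper
`--supports` the crux; (G⁰)_N and (G′)_N are HYPOTHESES, spelled inline; BSD is not proved by this.

Lead g4/g5's curve-free spanning hypothesis (G′)_N («the loops `{0 → b/4^k}`, `k ≥ 1`, span
`K_N = ker(H₁(X₀(N); 𝔽₂) → Q_N ⊗ 𝔽₂)`»; dual form = hypothesis `hG` of `exists_odd_re_cuspSymbol_of_cuspSpan`,
p592862) implies FLAT at every habitat⁺ newform of level `N` (`flatAtTwo_of_cuspSpan`, p593268). The proof uses the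
Hecke operator `T₂` exactly once: on the habitat `T₂ f = a₂(W) f = 0`. This file isolates what that proof needs:

  (G⁰)_N (dual form, inline): every additive `χ : Γ₀(N) → ZMod 2` which factors through the period homology, is
  KILLED BY `T₂` (`χ σ = 0` whenever `{∞, σ∞} = T₂^∨{∞, γ∞}` as functionals on `S₂(Γ₀(N))` — i.e. `χ ∘ T₂ = 0` on
  `H₁(X₀(N); ℤ) ⊆ S₂^∧`, where `T₂^∨` preserves the period homology by the tree's `dualMap_heckeT_mem_periodHomology`)
  and kills every `γ` with `|d(γ)| = 4^k`, `k ≥ 1`, is ZERO.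

Homologically: (G⁰)_N ⟺ «`V^{even}_N + T₂ H₁(X₀(N); 𝔽₂) = H₁(X₀(N); 𝔽₂)`» (annihilators: `V^⊥ ∩ ker T₂^t = 0`). It is
implied by (G′)_N (§2: a `ψ ∘ d` killed by `T₂` vanishes, because `T₂(ψ ∘ d) = 3·(ψ ∘ d)` by lead g5's Hecke–Shimura
lemma `exists_cuspSymbol_heckeT_lowerRight`, p592546) — so every exact certificate of (G′)_N (all odd `N ≤ 2999`, the
five smallest habitat⁺ conductors; `FlatCuspSpan.md` §4) certifies (G⁰)_N — and it is WEAKER: it constrains only the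
`T₂`-nilpotent generalised eigenspace of `H₁(X₀(N); 𝔽₂)` (at a level where every mod-2 Hecke eigensystem has `ā₂ ≠ 0`,
e.g. `N = 23` with `ā₂² + ā₂ + 1 = 0`, `T₂` is invertible on `H₁ ⊗ 𝔽₂` and (G⁰)_N holds with nothing to check, while
(G′)_N still asserts `V^{even} = K_N`). For a PROOF of FLAT class-wide this is the statement to aim at; see the crux
workfile `Cruxes/SignedMuVanishingAtTwoPlus/CuspSpanIhara.md` (this seat) for the structure theory ((G′)_N ⟺
«vanishing on the `4^k`-classes ⟹ invariance under `x ↦ 4x` on the cusps of type `∞`» + Ihara's lemma mod `2`).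

* §1 `exists_periodFunctional_eq_dualMap_heckeT` — `T_p^∨{∞, γ∞} = {∞, σ∞}` for some `σ ∈ Γ₀(N)` (the tree's
  `dualMap_heckeT_mem_periodHomology` + `coe_periodHomology_eq_range`); `exists_odd_re_cuspSymbol_of_cuspSpanNil` —
  for `f ∈ S₂(Γ₀(N))` with `Ω⁺_f ≠ 0` and `T₂ f = a f`, `a` EVEN: (G⁰)_N ⟹ some `γ` with `|d(γ)| = 4^k`, `k ≥ 1`, has
  `2 re{∞, γ∞}_f / Ω⁺_f` ODD (the mod-2 plus character `χ_f` is additive, factors through the period homology, is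
  killed by `T₂` since `m_σ = a · m_γ`, and is non-zero since some `m_γ = 1`; nothing about `ψ ∘ d` is needed).
* §2 `cuspSpanNil_of_cuspSpan` — **(G′)_N ⟹ (G⁰)_N** for `2 ∤ N` (Hecke–Shimura: `∏ d(δⱼ) · d(δ') = d(γ)³`).
* §3 `exists_two_le_norm_ratPlusSymbol_of_cuspSpanNil`, `flatAtTwo_of_cuspSpanNil` — (G⁰)_{N_W} ⟹ `2 ∤ L♭` for every
  Pollack pair of the habitat⁺ newform (over p593268's §§1–2 and the FlatSymbols door p578368);
  `flatMuZeroAtTwo_of_cuspSpanNil` — (G⁰)_N for all odd `N` ⟹ the registered stub `FlatMuZeroAtTwo` (verbatim);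
  `signedMuAnalyticAtTwoPlus_of_abbesUllmo_of_cuspSpanNil` — with Abbes–Ullmo by name, the analytic child 21437;
  `signedMuVanishingAtTwoPlus_of_seed_of_abbesUllmo_of_cuspSpanNil` — the crux BY NAME from {seed 21438, AU, (G⁰)}.

References: J. E. Cremona, *Algorithms for modular elliptic curves* (1997) §2.1, §2.4 (2.4.1)–(2.4.2), §2.8
[CremonaAlgorithms1997]; S. Ling, J. Oesterlé, Astérisque 196–197 (1991) Thm 6 [LingOesterle1991]; R. Pollack, Duke
Math. J. 118 (2003) Conj. 6.3, Prop. 6.18 [Pollack2003]; B. Mazur, J. Tate, J. Teitelbaum, Invent. Math. 84 (1986) §I.8,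
§I.13 [MazurTateTeitelbaum1986Invent]; A. Abbes, E. Ullmo, Compositio Math. 103 (1996) Thm A [AbbesUllmo1996].
-/

set_option autoImplicit false
set_option linter.dupNamespace false

noncomputable section

open scoped Classical MatrixGroups ModularForm

open CongruenceSubgroup WeierstrassCurve Literature.NumberTheory.EllipticCurves
  Literature.NumberTheory.EllipticCurves.ModularForms Literature.NumberTheory.EllipticCurves.Rank1Residual
  Literature.NumberTheory.IwasawaTheory Summit.BirchSwinnertonDyer.Rank1Residual.Supersingular
  Summit.BirchSwinnertonDyer.BirchSwinnertonDyer.Theses.ResidualThetaTransportAtTwo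

namespace Summit.BirchSwinnertonDyer.BirchSwinnertonDyer.Theorems.SignedMuAtTwo

/-! ## §1. One cusp form: (G⁰)_N ⟹ an odd doubled plus period on a `4^k`-class -/

section OneForm

variable {N : ℕ} [NeZero N] (f : CuspForm (Gamma0 N) 2)

/-- **`T_p^∨` of a period functional is a period functional**: for `p` prime and `γ ∈ Γ₀(N)` there is `σ ∈ Γ₀(N)`
with `{∞, σ∞}_h = {∞, γ∞}_{T_p h}` for every `h ∈ S₂(Γ₀(N))` (Cremona's compatibility (2.4.2): `T_p^∨` preserves
`H₁(X₀(N); ℤ) ⊆ S₂^∧`, `dualMap_heckeT_mem_periodHomology`; and every element of the period homology is a single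
`{∞, σ∞}`, `coe_periodHomology_eq_range`). [cite: CremonaAlgorithms1997, §2.4 (2.4.2) and Lemma 2.1.1] -/
theorem exists_periodFunctional_eq_dualMap_heckeT {p : ℕ} [NeZero p] (hp : p.Prime) (γ : Gamma0 N) :
    ∃ σ : Gamma0 N, periodFunctional N σ = (heckeT (Gamma0 N) 2 p).dualMap (periodFunctional N γ) := by
  have hmem : (heckeT (Gamma0 N) 2 p).dualMap (periodFunctional N γ) ∈
      (periodHomology N : Set (Module.Dual ℂ (CuspForm (Gamma0 N) 2))) :=
    dualMap_heckeT_mem_periodHomology N hp (periodFunctional_mem_periodHomology N γ)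
  rw [coe_periodHomology_eq_range] at hmem
  obtain ⟨σ, hσ⟩ := hmem
  exact ⟨σ, hσ⟩

/-- **(G⁰)_N ⟹ an odd doubled plus period on a `4^k`-class, for a `T₂`-eigenform with EVEN eigenvalue.**
Let `f ∈ S₂(Γ₀(N))` with `Ω⁺_f ≠ 0` and `T₂ f = a f`, `a ∈ ℤ` even. ASSUME the dual HECKE-WEAKENED spanning hypothesis
(G⁰)_N (`hG0`): every `χ : Γ₀(N) → ZMod 2` that is additive, factors through the period homology
(`{∞, γ∞} = {∞, δ∞}` as functionals ⟹ `χ γ = χ δ`), is KILLED BY `T₂` (`χ σ = 0` whenever `{∞, σ∞} = T₂^∨{∞, γ∞}`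
as functionals on `S₂(Γ₀(N))`), and kills every `γ` with `|d(γ)| = 4^k`, `k ≥ 1`, vanishes identically. THEN some
`γ ∈ Γ₀(N)` with `|d(γ)| = 4^k`, `k ≥ 1`, has `2 re{∞, γ∞}_f / Ω⁺_f` ODD. Proof: the mod-2 plus character
`χ_f(γ) = m_γ mod 2` (`re{∞, γ∞}_f = m_γ Ω⁺_f/2`) is additive, factors through the period homology, and is killed by
`T₂` (`m_σ Ω⁺/2 = re{∞, γ∞}_{T₂ f} = a · m_γ Ω⁺/2` with `a` even); if it killed all `4^k`-classes it would vanish by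
`hG0`, contradicting `m_γ = 1` at some `γ` (`exists_re_cuspSymbol_eq_plusPeriod_half`). Homologically (G⁰)_N says
`V^{even}_N + T₂ H₁(X₀(N); 𝔽₂) = H₁(X₀(N); 𝔽₂)`; it is implied by lead g4's (G′)_N (§2) and concerns only the
`T₂`-nilpotent part of `H₁ ⊗ 𝔽₂`. (G⁰)_N is NOT asserted (hypothesis). [cite: Pollack2003, Conj. 6.3 (μ⁻ = 0 at 2; (G⁰)_N is the exact curve-free input of its habitat case)] [cite: CremonaAlgorithms1997, §2.4 (2.4.2), §2.8] -/
theorem exists_odd_re_cuspSymbol_of_cuspSpanNil (hΩ : plusPeriod f ≠ 0) {a : ℤ}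
    (hT : heckeT (Gamma0 N) 2 2 f = (a : ℂ) • f) (ha : Even a)
    (hG0 : ∀ χ : Gamma0 N → ZMod 2,
      (∀ γ δ : Gamma0 N, χ (γ * δ) = χ γ + χ δ) →
      (∀ γ δ : Gamma0 N, periodFunctional N γ = periodFunctional N δ → χ γ = χ δ) →
      (∀ γ σ : Gamma0 N,
        periodFunctional N σ = (heckeT (Gamma0 N) 2 2).dualMap (periodFunctional N γ) → χ σ = 0) →
      (∀ γ : Gamma0 N, (∃ k : ℕ, 1 ≤ k ∧ ((γ : SL(2, ℤ)) 1 1).natAbs = 4 ^ k) → χ γ = 0) →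
      ∀ γ : Gamma0 N, χ γ = 0) :
    ∃ γ : Gamma0 N, (∃ k : ℕ, 1 ≤ k ∧ ((γ : SL(2, ℤ)) 1 1).natAbs = 4 ^ k) ∧
      ∃ m : ℤ, Odd m ∧ (cuspSymbol f γ).re = m * (plusPeriod f / 2) := by
  by_contra H
  push Not at H
  choose m hm using exists_int_re_cuspSymbol_eq f hΩ
  -- the mod-2 plus character `χ_f`
  have hmul : ∀ γ δ : Gamma0 N, m (γ * δ) = m γ + m δ := by
    intro γ δ
    apply int_eq_of_mul_plusPeriod_half_eq f hΩ
    have h := cuspSymbol_mul_holds f γ δ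
    have := congrArg Complex.re h
    rw [Complex.add_re, hm, hm, hm] at this
    rw [this]; push_cast; ring
  have hfac : ∀ γ δ : Gamma0 N, periodFunctional N γ = periodFunctional N δ → m γ = m δ := by
    intro γ δ h
    apply int_eq_of_mul_plusPeriod_half_eq f hΩ
    rw [← hm, ← hm, ← periodFunctional_apply N γ f, ← periodFunctional_apply N δ f, h]
  -- killed by `T₂`: `m_σ = a · m_γ` is even
  have hT2 : ∀ γ σ : Gamma0 N,
      periodFunctional N σ = (heckeT (Gamma0 N) 2 2).dualMap (periodFunctional N γ) →
      ((m σ : ℤ) : ZMod 2) = 0 := by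
    intro γ σ hσ
    have h1 : cuspSymbol f σ = (a : ℂ) * cuspSymbol f γ := by
      have := congrArg (fun φ : Module.Dual ℂ (CuspForm (Gamma0 N) 2) ↦ φ f) hσ
      simp only [periodFunctional_apply, LinearMap.dualMap_apply] at this
      rw [this, hT, cuspSymbol_smul]
    have h2 : m σ = a * m γ := by
      apply int_eq_of_mul_plusPeriod_half_eq f hΩ
      have := congrArg Complex.re h1
      rw [show ((a : ℂ)) = ((a : ℝ) : ℂ) by norm_cast, Complex.re_ofReal_mul, hm, hm] at this
      rw [this]; push_cast; ring
    obtain ⟨r, hr⟩ := ha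
    rw [h2, hr]; push_cast
    rw [← two_mul, mul_assoc]
    exact mul_eq_zero_of_left (by decide) _
  have hkill : ∀ γ : Gamma0 N, (∃ k : ℕ, 1 ≤ k ∧ ((γ : SL(2, ℤ)) 1 1).natAbs = 4 ^ k) →
      ((m γ : ℤ) : ZMod 2) = 0 := by
    intro γ hγ
    have hne := H γ hγ (m γ)
    have heven : Even (m γ) := by
      by_contra hodd
      exact hne (Int.not_even_iff_odd.mp hodd) (hm γ)
    obtain ⟨r, hr⟩ := heven
    rw [hr]; push_cast
    rw [← two_mul]
    exact mul_eq_zero_of_left (by decide) _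
  have hzero := hG0 (fun γ ↦ ((m γ : ℤ) : ZMod 2)) (fun γ δ ↦ by simp only [hmul]; push_cast; rfl)
    (fun γ δ h ↦ by simp only [hfac γ δ h]) hT2 hkill
  -- but some `m_γ = 1`
  obtain ⟨γ₀, hγ₀⟩ := exists_re_cuspSymbol_eq_plusPeriod_half f hΩ
  have h1 : m γ₀ = 1 := int_eq_of_mul_plusPeriod_half_eq f hΩ (by rw [← hm, hγ₀]; push_cast; ring)
  have := hzero γ₀
  rw [h1] at this
  exact absurd this (by decide)

end OneForm

/-! ## §2. (G′)_N ⟹ (G⁰)_N at odd level -/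

section Comparison

variable {N : ℕ} [NeZero N]

/-- **(G′)_N ⟹ (G⁰)_N (`2 ∤ N`).** If every additive `χ : Γ₀(N) → ZMod 2` through the period homology that kills the
`4^k`-classes is `ψ ∘ d` (lead g4/g5's dual (G′)_N, `hG`), then every such `χ` that is moreover killed by `T₂`
vanishes: by the Hecke–Shimura lemma (`exists_cuspSymbol_heckeT_lowerRight`, p592546) `T₂^∨{∞, γ∞} = {∞, σ∞}` with
`σ = δ₀ δ₁ δ'` and `d(δ₀) d(δ₁) d(δ') = d(γ)³` in `ZMod N`, so `0 = χ(σ) = ψ(d(γ)³) = 3 ψ(d(γ)) = χ(γ)`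
(«`T₂ = 3 ≡ 1` on the Shimura classes mod 2»). Hence every exact per-level certificate of (G′)_N is one of (G⁰)_N.
[cite: LingOesterle1991, Thm. 6 (character form)] [cite: CremonaAlgorithms1997, §2.4 (2.4.2)] -/
theorem cuspSpanNil_of_cuspSpan (h2N : ¬ 2 ∣ N)
    (hG : ∀ χ : Gamma0 N → ZMod 2,
      (∀ γ δ : Gamma0 N, χ (γ * δ) = χ γ + χ δ) →
      (∀ γ δ : Gamma0 N, periodFunctional N γ = periodFunctional N δ → χ γ = χ δ) →
      (∀ γ : Gamma0 N, (∃ k : ℕ, 1 ≤ k ∧ ((γ : SL(2, ℤ)) 1 1).natAbs = 4 ^ k) → χ γ = 0) →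
      ∃ ψ : ZMod N → ZMod 2, (∀ x y : ZMod N, IsUnit x → IsUnit y → ψ (x * y) = ψ x + ψ y) ∧
        ∀ γ : Gamma0 N, χ γ = ψ ((((γ : SL(2, ℤ)) 1 1 : ℤ) : ZMod N))) :
    ∀ χ : Gamma0 N → ZMod 2,
      (∀ γ δ : Gamma0 N, χ (γ * δ) = χ γ + χ δ) →
      (∀ γ δ : Gamma0 N, periodFunctional N γ = periodFunctional N δ → χ γ = χ δ) →
      (∀ γ σ : Gamma0 N,
        periodFunctional N σ = (heckeT (Gamma0 N) 2 2).dualMap (periodFunctional N γ) → χ σ = 0) →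
      (∀ γ : Gamma0 N, (∃ k : ℕ, 1 ≤ k ∧ ((γ : SL(2, ℤ)) 1 1).natAbs = 4 ^ k) → χ γ = 0) →
      ∀ γ : Gamma0 N, χ γ = 0 := by
  intro χ hadd hfac hT2 hkill γ
  obtain ⟨ψ, hψ, hχψ⟩ := hG χ hadd hfac hkill
  haveI : NeZero (2 : ℕ) := ⟨two_ne_zero⟩
  obtain ⟨δ, δ', hsum, hprod⟩ := exists_cuspSymbol_heckeT_lowerRight (N := N) Nat.prime_two h2N γ
  -- `σ := δ₀ δ₁ δ'` realises `T₂^∨{∞, γ∞}`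
  have hσ : periodFunctional N (δ 0 * δ 1 * δ') = (heckeT (Gamma0 N) 2 2).dualMap (periodFunctional N γ) := by
    ext h
    rw [periodFunctional_mul, periodFunctional_mul, LinearMap.dualMap_apply]
    simp only [LinearMap.add_apply, periodFunctional_apply, hsum h, Fin.sum_univ_two]
  have h0 := hT2 γ _ hσ
  rw [hadd, hadd, hχψ, hχψ, hχψ, ← hψ _ _ (isUnit_gamma0_apply_one_one (δ 0)) (isUnit_gamma0_apply_one_one (δ 1)),
    ← hψ _ _ ((isUnit_gamma0_apply_one_one (δ 0)).mul (isUnit_gamma0_apply_one_one (δ 1)))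
      (isUnit_gamma0_apply_one_one δ')] at h0
  rw [Fin.prod_univ_two] at hprod
  rw [hprod, map_pow_eq_smul_of_mul_on_units hψ (isUnit_gamma0_apply_one_one γ), ← hχψ] at h0
  -- `3 • χ γ = χ γ` in `ZMod 2`
  have h3 : (3 : ℕ) • χ γ = χ γ := by
    rw [nsmul_eq_mul]
    have : ((3 : ℕ) : ZMod 2) = 1 := by decide
    rw [this, one_mul]
  rwa [h3] at h0

/-- (G′)_N at every odd level ⟹ (G⁰)_N at every odd level (pointwise `cuspSpanNil_of_cuspSpan`). [cite: LingOesterle1991, Thm. 6] -/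
theorem cuspSpanNil_of_cuspSpan_all
    (hG : ∀ (N : ℕ) [NeZero N], ¬ 2 ∣ N → ∀ χ : Gamma0 N → ZMod 2,
      (∀ γ δ : Gamma0 N, χ (γ * δ) = χ γ + χ δ) →
      (∀ γ δ : Gamma0 N, periodFunctional N γ = periodFunctional N δ → χ γ = χ δ) →
      (∀ γ : Gamma0 N, (∃ k : ℕ, 1 ≤ k ∧ ((γ : SL(2, ℤ)) 1 1).natAbs = 4 ^ k) → χ γ = 0) →
      ∃ ψ : ZMod N → ZMod 2, (∀ x y : ZMod N, IsUnit x → IsUnit y → ψ (x * y) = ψ x + ψ y) ∧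
        ∀ γ : Gamma0 N, χ γ = ψ ((((γ : SL(2, ℤ)) 1 1 : ℤ) : ZMod N))) :
    ∀ (N : ℕ) [NeZero N], ¬ 2 ∣ N → ∀ χ : Gamma0 N → ZMod 2,
      (∀ γ δ : Gamma0 N, χ (γ * δ) = χ γ + χ δ) →
      (∀ γ δ : Gamma0 N, periodFunctional N γ = periodFunctional N δ → χ γ = χ δ) →
      (∀ γ σ : Gamma0 N,
        periodFunctional N σ = (heckeT (Gamma0 N) 2 2).dualMap (periodFunctional N γ) → χ σ = 0) →
      (∀ γ : Gamma0 N, (∃ k : ℕ, 1 ≤ k ∧ ((γ : SL(2, ℤ)) 1 1).natAbs = 4 ^ k) → χ γ = 0) →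
      ∀ γ : Gamma0 N, χ γ = 0 :=
  fun N _ h2N ↦ cuspSpanNil_of_cuspSpan h2N (hG N h2N)

end Comparison

/-! ## §3. The habitat⁺: (G⁰)_{N_W} ⟹ FLAT; (G⁰)_N for all odd `N` ⟹ the stub, the analytic child, the crux mod seed/AU -/

section Flat

variable {N : ℕ} [NeZero N] (f : CuspForm (Gamma0 N) 2)

/-- **(G⁰)_N ⟹ a half-integral even-layer plus symbol**, for a normalised newform `f ∈ S₂(Γ₀(N))` with rational
coefficients, ODD level and `a₂(f) = 0`: some `[5^s/2^{n+2}]⁺_f` with `n` EVEN has `2`-adic norm `≥ 2` (§1 with `a = 0`,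
then p593268's `exists_ratPlusSymbol_pow_cyclotomicGenerator_eq` and `norm_ratPlusSymbol_eq_two_of_odd`).
[cite: Pollack2003, Conj. 6.3] [cite: MazurTateTeitelbaum1986Invent, §I.8, §I.13] -/
theorem exists_two_le_norm_ratPlusSymbol_of_cuspSpanNil (hf : IsNewform0 f) (hQ : coeffField f = ⊥)
    (h2N : ¬ 2 ∣ N) (ha₂ : cuspCoeff f 2 = 0)
    (hG0 : ∀ χ : Gamma0 N → ZMod 2,
      (∀ γ δ : Gamma0 N, χ (γ * δ) = χ γ + χ δ) →
      (∀ γ δ : Gamma0 N, periodFunctional N γ = periodFunctional N δ → χ γ = χ δ) →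
      (∀ γ σ : Gamma0 N,
        periodFunctional N σ = (heckeT (Gamma0 N) 2 2).dualMap (periodFunctional N γ) → χ σ = 0) →
      (∀ γ : Gamma0 N, (∃ k : ℕ, 1 ≤ k ∧ ((γ : SL(2, ℤ)) 1 1).natAbs = 4 ^ k) → χ γ = 0) →
      ∀ γ : Gamma0 N, χ γ = 0) :
    ∃ n : ℕ, Even n ∧ ∃ s : ZMod (2 ^ n),
      2 ≤ ‖((ratPlusSymbol f ((((cyclotomicGenerator 2 : ZMod (2 ^ (n + 2))) ^ s.val).val : ℚ) /
        (2 : ℚ) ^ (n + 2)) : ℚ) : ℚ_[2])‖ := by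
  have hΩ : plusPeriod f ≠ 0 := (IsNewform0.plusPeriod_pos_holds hf hQ).ne'
  have hT : heckeT (Gamma0 N) 2 2 f = ((0 : ℤ) : ℂ) • f := by
    rw [IsNewform0.heckeT_eq_coeff_smul hf Nat.prime_two]
    change cuspCoeff f 2 • f = _
    rw [ha₂]; simp
  obtain ⟨γ, ⟨k, hk1, hk⟩, m, hmo, hm⟩ :=
    exists_odd_re_cuspSymbol_of_cuspSpanNil f hΩ hT ⟨0, rfl⟩ hG0
  -- `|d| = 4^k = 2^{(2k-2)+2}`
  have hd : ((γ : SL(2, ℤ)) 1 1).natAbs = 2 ^ ((2 * k - 2) + 2) := by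
    rw [hk, show (4 : ℕ) = 2 ^ 2 by norm_num, ← pow_mul]
    congr 1; omega
  have hd0 : (γ : SL(2, ℤ)) 1 1 ≠ 0 := by
    intro h0
    rw [h0, Int.natAbs_zero] at hk
    exact absurd hk.symm (pow_ne_zero k (by norm_num))
  have heven : Even ((γ : SL(2, ℤ)) 1 1) := by
    have h2 : (2 : ℤ) ∣ (γ : SL(2, ℤ)) 1 1 := by
      rw [← Int.natAbs_dvd_natAbs, hk]
      change 2 ∣ 4 ^ k
      exact dvd_pow (by norm_num) (by omega)
    exact even_iff_two_dvd.mpr h2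
  have hb : Odd ((γ : SL(2, ℤ)) 0 1) := odd_apply_zero_one_of_even _ heven
  obtain ⟨s, hs⟩ := exists_ratPlusSymbol_pow_cyclotomicGenerator_eq f hb (2 * k - 2) hd
  refine ⟨2 * k - 2, ⟨k - 1, by omega⟩, s, ?_⟩
  rw [hs, norm_ratPlusSymbol_eq_two_of_odd f hf hQ h2N ha₂ γ hd0 hmo hm]

variable {W : WeierstrassCurve ℚ} [W.IsElliptic] [W.IsGloballyMinimal]

/-- **(G⁰)_{N_W} ⟹ FLAT at `(W, f)` on the habitat⁺.** For `W/ℚ` good supersingular at `2` with `a₂(W) = 0` and its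
newform `f` (level `N_W`, odd): if every additive `ZMod 2`-character of `Γ₀(N_W)` that factors through the period
homology, is killed by `T₂`, and kills all `γ` with `|d(γ)| = 4^k`, `k ≥ 1`, vanishes — the dual Hecke-weakened spanning
hypothesis (G⁰)_{N_W}, `f`-free and finite per level, implied by (G′)_{N_W} (§2) — then `2 ∤ L♭` for EVERY Pollack pair
`(L♯, L♭)` of `f` at `2` (μ(L♭_f) = 0). BSD is not proved by this; (G⁰)_{N_W} is a hypothesis.
[cite: Pollack2003, Conj. 6.3 and Prop. 6.18] -/
theorem flatAtTwo_of_cuspSpanNil [NeZero (W.conductorNorm ℤ)] {f : CuspForm (Gamma0 (W.conductorNorm ℤ)) 2}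
    (hf : IsNewformOf W f) (hss : GoodSS W 2) (ha : W.frobeniusTrace 2 = 0)
    (hG0 : ∀ χ : Gamma0 (W.conductorNorm ℤ) → ZMod 2,
      (∀ γ δ : Gamma0 (W.conductorNorm ℤ), χ (γ * δ) = χ γ + χ δ) →
      (∀ γ δ : Gamma0 (W.conductorNorm ℤ),
        periodFunctional (W.conductorNorm ℤ) γ = periodFunctional (W.conductorNorm ℤ) δ → χ γ = χ δ) →
      (∀ γ σ : Gamma0 (W.conductorNorm ℤ),
        periodFunctional (W.conductorNorm ℤ) σ =
          (heckeT (Gamma0 (W.conductorNorm ℤ)) 2 2).dualMap (periodFunctional (W.conductorNorm ℤ) γ) → χ σ = 0) →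
      (∀ γ : Gamma0 (W.conductorNorm ℤ), (∃ k : ℕ, 1 ≤ k ∧ ((γ : SL(2, ℤ)) 1 1).natAbs = 4 ^ k) → χ γ = 0) →
      ∀ γ : Gamma0 (W.conductorNorm ℤ), χ γ = 0) :
    ∀ Lplus Lminus : IwasawaAlgebra 2, IsPollackPair f 2 Lplus Lminus → ¬ PowerSeries.C (2 : ℤ_[2]) ∣ Lminus := by
  have h2N : ¬ 2 ∣ W.conductorNorm ℤ := not_two_dvd_conductorNorm_of_goodSS hss
  have ha₂ : cuspCoeff f 2 = 0 := by
    rw [hf.2 2, W.LFunction_apply_prime_eq_frobeniusTrace 2 hss.1, ha]; simp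
  obtain ⟨n, hn, s, hs⟩ :=
    exists_two_le_norm_ratPlusSymbol_of_cuspSpanNil f hf.1 hf.coeffField_eq_bot h2N ha₂ hG0
  exact flatAtTwo_of_two_le_norm_ratPlusSymbol hn hs

/-- **(G⁰)_N for every odd `N` ⟹ the registered stub `FlatMuZeroAtTwo` of line `birth`** (spelled verbatim: on the
habitat⁺, `2 ∤ L♭` for every Pollack pair of the newform at `2`). The hypothesis is the dual Hecke-weakened spanning
statement at every odd level (inline); nothing else. BSD is not proved by this. [cite: Pollack2003, Conj. 6.3 and Prop. 6.18] -/
theorem flatMuZeroAtTwo_of_cuspSpanNil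
    (hG0 : ∀ (N : ℕ) [NeZero N], ¬ 2 ∣ N → ∀ χ : Gamma0 N → ZMod 2,
      (∀ γ δ : Gamma0 N, χ (γ * δ) = χ γ + χ δ) →
      (∀ γ δ : Gamma0 N, periodFunctional N γ = periodFunctional N δ → χ γ = χ δ) →
      (∀ γ σ : Gamma0 N,
        periodFunctional N σ = (heckeT (Gamma0 N) 2 2).dualMap (periodFunctional N γ) → χ σ = 0) →
      (∀ γ : Gamma0 N, (∃ k : ℕ, 1 ≤ k ∧ ((γ : SL(2, ℤ)) 1 1).natAbs = 4 ^ k) → χ γ = 0) →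
      ∀ γ : Gamma0 N, χ γ = 0) :
    ∀ (W : WeierstrassCurve ℚ) [W.IsElliptic] [W.IsGloballyMinimal], ¬ W.HasCM → W.analyticRank = 0 →
      GoodSS W 2 → W.frobeniusTrace 2 = 0 → W.Δ < 0 →
      ∀ [NeZero (W.conductorNorm ℤ)] (f : CuspForm (Gamma0 (W.conductorNorm ℤ)) 2), IsNewformOf W f →
      ∀ (Lplus Lminus : IwasawaAlgebra 2), IsPollackPair f 2 Lplus Lminus → ¬ PowerSeries.C (2 : ℤ_[2]) ∣ Lminus :=
  fun W _ _ _ _ hss ha _ _ _f hf ↦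
    flatAtTwo_of_cuspSpanNil hf hss ha (hG0 (W.conductorNorm ℤ) (not_two_dvd_conductorNorm_of_goodSS hss))

/-- **(G⁰)_N for every odd `N` ∧ Abbes–Ullmo Thm A (by name) ⟹ the analytic child 21437 `SignedMuAnalyticAtTwoPlus`**
(through lead g0's `signedMuAnalyticAtTwoPlus_of_abbesUllmo_of_flatMuZero`, p569783). Conditional on the print fact
`abbesUllmo_not_dvd_maninConstant_of_not_dvd_level` and on the hypothesis (G⁰); BSD is not proved by this.
[cite: AbbesUllmo1996, Thm. A] [cite: Pollack2003, Conj. 6.3 and Prop. 6.18] -/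
theorem signedMuAnalyticAtTwoPlus_of_abbesUllmo_of_cuspSpanNil
    (hAU : abbesUllmo_not_dvd_maninConstant_of_not_dvd_level)
    (hG0 : ∀ (N : ℕ) [NeZero N], ¬ 2 ∣ N → ∀ χ : Gamma0 N → ZMod 2,
      (∀ γ δ : Gamma0 N, χ (γ * δ) = χ γ + χ δ) →
      (∀ γ δ : Gamma0 N, periodFunctional N γ = periodFunctional N δ → χ γ = χ δ) →
      (∀ γ σ : Gamma0 N,
        periodFunctional N σ = (heckeT (Gamma0 N) 2 2).dualMap (periodFunctional N γ) → χ σ = 0) →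
      (∀ γ : Gamma0 N, (∃ k : ℕ, 1 ≤ k ∧ ((γ : SL(2, ℤ)) 1 1).natAbs = 4 ^ k) → χ γ = 0) →
      ∀ γ : Gamma0 N, χ γ = 0) :
    SignedMuAnalyticAtTwoPlus :=
  signedMuAnalyticAtTwoPlus_of_abbesUllmo_of_flatMuZero hAU (flatMuZeroAtTwo_of_cuspSpanNil hG0)

/-- **The crux Kμ⁺ BY NAME from {seed child 21438, Abbes–Ullmo Thm A, (G⁰)_N for all odd `N`}** (over lead g3's
kernel-exact `signedMuVanishingAtTwoPlus_of_analytic_of_seed`, p585569: crux ⟺ 21437 ∧ 21438). Conditional on the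
research seed `SignedMuSeedAtTwoPlus`, the print fact and the hypothesis (G⁰); BSD is not proved by this.
[cite: AbbesUllmo1996, Thm. A] [cite: Pollack2003, Conj. 6.3 and Prop. 6.18] [cite: GreenbergVatsal2000, Prop. (2.8)] -/
theorem signedMuVanishingAtTwoPlus_of_seed_of_abbesUllmo_of_cuspSpanNil (hSeed : SignedMuSeedAtTwoPlus)
    (hAU : abbesUllmo_not_dvd_maninConstant_of_not_dvd_level)
    (hG0 : ∀ (N : ℕ) [NeZero N], ¬ 2 ∣ N → ∀ χ : Gamma0 N → ZMod 2,
      (∀ γ δ : Gamma0 N, χ (γ * δ) = χ γ + χ δ) →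
      (∀ γ δ : Gamma0 N, periodFunctional N γ = periodFunctional N δ → χ γ = χ δ) →
      (∀ γ σ : Gamma0 N,
        periodFunctional N σ = (heckeT (Gamma0 N) 2 2).dualMap (periodFunctional N γ) → χ σ = 0) →
      (∀ γ : Gamma0 N, (∃ k : ℕ, 1 ≤ k ∧ ((γ : SL(2, ℤ)) 1 1).natAbs = 4 ^ k) → χ γ = 0) →
      ∀ γ : Gamma0 N, χ γ = 0) :
    SignedMuVanishingAtTwoPlus :=
  signedMuVanishingAtTwoPlus_of_analytic_of_seed (signedMuAnalyticAtTwoPlus_of_abbesUllmo_of_cuspSpanNil hAU hG0) hSeed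

end Flat

end Summit.BirchSwinnertonDyer.BirchSwinnertonDyer.Theorems.SignedMuAtTwo

end
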